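import Summits.ResolutionOfSingularities.ResolutionOfSingularities.Theorems.MarkedTransferCampaignW46MohWindowShadeFormalInsepStatement
import HarnessLib

/-!
# [OURS · L1 W4.6 rung (iii)] The GEOMETRIC formally purely inseparable surface window — `J𝒪̂_ξ = (z^p + F(u₀, u₁))` in Cohen coordinates
# over a perfect COEFFICIENT FIELD OF THE POINT (not over the ground field): regime, rung, nesting (statement typing; closer by name in
# `…MohWindowShadeFormalGeomTerminates.lean`)

Cell `res-hironaka`, LADDER-RESOLUTION rung L (D-0089), slot W4.6 rung (iii) «purely inseparable `z^p = f(x, y)` with `ord f < 2p`»;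
seat res-L1-s46-pv-6 (gen 7). Host route MarkedTransfer (`HypersurfaceOrderReduction`, stmt-ResolutionOfSingularities-16155),
`--supports … --as helper`; kind definition (TYPED-OURS: 3 definitions + nesting). Sibling of `…MohWindowShadeFormalInsepStatement.lean`
(p543815), whose predicate `MohWindowSurfaceFormalInsepAt p K R I` asks for Cohen coordinates `R̂ ≃+* K⟦z, u₀, u₁⟧` with coefficients in the
GROUND FIELD `K` — which at a NON-RATIONAL singular point `ξ` (residue field `κ(ξ) ⊋ K`) forces `κ(ξ) ≅ K` as abstract fields
(res-L1-s46-pv-2's residue (R1); HOME/L/res-L1-s46-pv-6/GENERAL-REGIME-ANALYSIS.md §5). Over an infinite perfect NON-closed ground field the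
singular points of the stages of a permissible sequence need not be rational, and the honest reading of «`z^p = f(x, y)` formally at `ξ`» is:
Cohen coordinates over the residue field OF THE POINT.

WHAT IS TYPED
* `CampaignW46.MohWindowSurfaceFormalGeomAt p R I` (ring level): for SOME perfect field `L` of characteristic `p` (a coefficient field of `R̂`;
  at a closed point of a stage over a perfect ground field `K` the residue field `κ(ξ)`, a finite extension of `K`, is such a field — we
  demand perfectness explicitly rather than derive it, DESIGN POINT (PERF)), SOME ring isomorphism `e : R̂ ≃+* L⟦z, u₀, u₁⟧`, some `f₀` with
  `I = (f₀)`, some unit `w` and SOME power series `F ∈ L⟦y₀, y₁⟧`: `e f₀ = w · (z^p + F(u₀, u₁))`. No cleaning, window or isolatedness is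
  demanded of `F` (read from o1's regime of record where needed, as in gen 6).
* `CampaignW46.Regime.mohWindowSurfaceFormalGeom := regimeMohWindowSurfaceInsep ∧ ∀ ξ ∈ Sing(E), MohWindowSurfaceFormalGeomAt p 𝒪_{Z,ξ} J_ξ`.
* `CampaignW46.MohWindowSurfaceFormalGeomPermissiblyTerminates p K := PermissiblyTerminates Regime.mohWindowSurfaceFormalGeom`.
NESTING (pure logic): over a perfect ground field `FormalInsepAt ⇒ FormalGeomAt` (take `L := K`), so `Regime.mohWindowSurfaceFormalInsep ≤
Regime.mohWindowSurfaceFormalGeom` and THIS rung implies gen 6's rung `MohWindowSurfaceFormalInsepPermissiblyTerminates p K` (hence all of gens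
4–6's (iii) rungs) over every perfect `K` — `mohWindowSurfaceFormalInsepPermissiblyTerminates_of_geom`; `FormalGeom ≤ Insep` (o1).
CLOSER (separate file, this seat gen 7): `mohWindowSurfaceFormalGeomPermissiblyTerminates : ∀ K, MohWindowSurfaceFormalGeomPermissiblyTerminates p K`
— EVERY ground field of characteristic `p`, no rationality hypothesis — via the NON-RATIONAL formal step (`…FormalNR*.lean`: Hensel lift of the
point's separable minimal polynomial, coefficient fields growing along the thread inside an algebraic closure, the power-series shade model
over that closure, Galois descent of the `p`-fold formal curve).

DESIGN POINT (PERF). Perfectness of the coefficient field is LOAD-BEARING for the model (cleaning of `p`-th power monomials needs `p`-th roots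
of coefficients; separability of the minimal polynomials of the thread points needs a perfect base). Over a perfect ground field `K` it holds
at every closed point; the predicate demands it so that the rung is a statement about EVERY ground field of characteristic `p`.
(VAC) VACUITY SELF-CHECK. Not trivially true: over an algebraically closed `K`, `((z^p + x^d + y^d)·𝒪, p)` on `𝔸³_K`, `p < d < 2p`, inhabits
gen 6's `Regime.mohWindowSurfaceFormalInsep` (p550582 `exists_singular_state_mohWindowSurfaceFormalInsep`), hence this regime by the nesting;
arbitrarily long in-window chains exist (gen 2 `…TerminatesFinWitness`). Not trivially false: implied by o1's rung, no in-tree refutation. The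
regime is LARGER than gen 6's (`L` is not tied to `K`), so the rung here is the STRONGEST of this seat's (iii) rungs. AI-written; AI review
is weaker than expert review. H. Hironaka, ms. 2017-03-23, Th. 16.6 p.84 l.4–20, Th. 16.13 p.87 l.26–28 — scope only, under adjudication,
not cited as fact [Hironaka2017]. Reference for the normal form: H. Hauser, Bull. AMS 47 (2010) §§F–G [Hauser2010]; coefficient fields:
H. Matsumura, *Commutative Ring Theory* (1986) Thm. 28.3 [Matsumura1987].
-/

noncomputable section

set_option linter.dupNamespace false -- mandated namespace of this single-conjunct summit

open CategoryTheory AlgebraicGeometry TopologicalSpace IsLocalRing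

namespace Summit.ResolutionOfSingularities.ResolutionOfSingularities.Theorems

namespace CampaignW46

open Literature.AlgebraicGeometry.Resolution
open Literature.AlgebraicGeometry.Resolution.Hauser2010
open Literature.AlgebraicGeometry.Hironaka2017.S02Preliminaries
open Literature.AlgebraicGeometry.Hironaka2017.Datum

variable {p : ℕ} [Fact p.Prime] {K : Type} [Field K] [CharP K p]

/-! ## §1 The predicate (ring level) -/

/-- [OURS · L1 W4.6 rung (iii)] replaces the role of the hypothesis «purely inseparable SURFACE `z^p = f(x, y)`» (RESCUE-SEED W4.6 (iii);
Hauser 2010 §F) READ IN THE COMPLETION OVER A COEFFICIENT FIELD OF THE POINT with an ARBITRARY power-series residual part; NOT a statement of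
the manuscript. For a local ring `R` and an ideal `I`: for SOME perfect field `L` of characteristic `p`, SOME ring isomorphism
`e : R̂ ≃+* L⟦z, u₀, u₁⟧` (`z = X none`, `u_l = X (some l)`), some `f₀` with `I = (f₀)`, some unit `w` and some power series `F ∈ L⟦y₀, y₁⟧`:
`e f₀ = w · (z^p + F(u₀, u₁))`. DESIGN POINT (PERF): perfectness of `L` is demanded, not derived. [cite: Hauser2010, §F (setting f = x^p + y^r g)]
[cite: Matsumura1987, Thm. 28.3] -/
def MohWindowSurfaceFormalGeomAt (p : ℕ) (R : Type) [CommRing R] [IsLocalRing R] (I : Ideal R) : Prop :=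
  ∃ (L : Type) (_ : Field L) (_ : CharP L p) (_ : PerfectField L)
    (e : AdicCompletion (maximalIdeal R) R ≃+* MvPowerSeries (Option (Fin 2)) L) (f₀ : R) (w : MvPowerSeries (Option (Fin 2)) L)
    (F : MvPowerSeries (Fin 2) L), I = Ideal.span {f₀} ∧ IsUnit w ∧
      e (algebraMap R (AdicCompletion (maximalIdeal R) R) f₀) =
        w * (MvPowerSeries.X none ^ p + MvPowerSeries.rename (some : Fin 2 → Option (Fin 2)) F)

omit [Fact p.Prime] in
/-- **Formally purely inseparable over the (perfect) ground field ⇒ geometrically formally purely inseparable** (take `L := K`).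
[folklore] -/
theorem MohWindowSurfaceFormalInsepAt.formalGeomAt [PerfectField K] {R : Type} [CommRing R] [IsLocalRing R] {I : Ideal R}
    (h : MohWindowSurfaceFormalInsepAt p K R I) : MohWindowSurfaceFormalGeomAt p R I := by
  obtain ⟨e, f₀, w, F, hI, hw, hE⟩ := h
  exact ⟨K, inferInstance, inferInstance, inferInstance, e, f₀, w, F, hI, hw, hE⟩

/-! ## §2 The regime and the rung -/

/-- [OURS · L1 W4.6 rung (iii)] **Regime «geometric formally purely inseparable surface window»** — replaces the role of the restriction
(iii) of RESCUE-SEED W4.6 («purely inseparable `z^p = f(x, y)`, `ord f < 2p`») read in the completed local rings at EVERY stage OVER THE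
RESIDUE FIELDS OF THE POINTS; NOT a statement of the manuscript: o1's `regimeMohWindowSurfaceInsep` (isolated singular locus of closed points;
window germ `z^b + f`, `f ∈ (x, y)^d`, `b = p < d < 2b`, at every singular point) AND `MohWindowSurfaceFormalGeomAt p 𝒪_{Z,ξ} J_ξ` at every
`ξ ∈ Sing(E)`. [folklore] -/
def Regime.mohWindowSurfaceFormalGeom : Regime p K := fun A E =>
  regimeMohWindowSurfaceInsep A E ∧ ∀ ξ ∈ E.sing, MohWindowSurfaceFormalGeomAt p (A.Z.presheaf.stalk ξ) (stalkIdeal E.J ξ)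

/-- Pure logic: the geometric formally purely inseparable regime is a sub-regime of o1's regime of record. [folklore] -/
theorem Regime.mohWindowSurfaceFormalGeom_le (A : AmbientDatum p K) (E : IdealExponent A.Z)
    (h : Regime.mohWindowSurfaceFormalGeom A E) : regimeMohWindowSurfaceInsep A E :=
  h.1

/-- Pure logic: over a perfect ground field, gen 6's regime (p543815) is a sub-regime. [folklore] -/
theorem Regime.mohWindowSurfaceFormalInsep_le_formalGeom [PerfectField K] (A : AmbientDatum p K) (E : IdealExponent A.Z)
    (h : Regime.mohWindowSurfaceFormalInsep A E) : Regime.mohWindowSurfaceFormalGeom A E :=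
  ⟨h.1, fun ξ hξ => (h.2 ξ hξ).formalGeomAt⟩

/-- [OURS · L1 W4.6 rung (iii)] **RUNG (iii), GEOMETRIC FORMALLY PURELY INSEPARABLE SURFACE WINDOW, résumé-free** — replaces the role of the
termination clause of Th. 16.13 p.87 l.26–28 («repeatedly but finitely many times») for the typed Th. 16.6 procedure restricted, at every stage,
to `Regime.mohWindowSurfaceFormalGeom`; NOT a statement of the manuscript: there is NO infinite §2.1-permissible sequence (standard ideal
exponents, permissible centres — here single closed points —, blow-ups, controlled transforms) all of whose stages lie in the regime
(`PermissiblyTerminates`). To be PROVED for EVERY ground field of characteristic `p` in `…MohWindowShadeFormalGeomTerminates.lean`. VACUITY: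
module docstring (VAC). [folklore] -/
def MohWindowSurfaceFormalGeomPermissiblyTerminates (p : ℕ) [Fact p.Prime] (K : Type) [Field K] [CharP K p] : Prop :=
  PermissiblyTerminates (Regime.mohWindowSurfaceFormalGeom (p := p) (K := K))

/-! ## §3 Nesting of the rungs (pure logic) -/

/-- o1's rung `MohWindowSurfaceInsepPermissiblyTerminates` implies this rung (antitonicity in the regime). [folklore] -/
theorem mohWindowSurfaceFormalGeomPermissiblyTerminates_of_insep (h : MohWindowSurfaceInsepPermissiblyTerminates p K) :
    MohWindowSurfaceFormalGeomPermissiblyTerminates p K :=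
  permissiblyTerminates_antitone (fun A E hAE => Regime.mohWindowSurfaceFormalGeom_le A E hAE) h

/-- **This rung implies gen 6's rung** `MohWindowSurfaceFormalInsepPermissiblyTerminates p K` (p543815) over every perfect ground field, hence
gens 4–6's rungs (iii) (`…_of_formalInsep` nestings of p543815). [folklore] -/
theorem mohWindowSurfaceFormalInsepPermissiblyTerminates_of_geom [PerfectField K] (h : MohWindowSurfaceFormalGeomPermissiblyTerminates p K) :
    MohWindowSurfaceFormalInsepPermissiblyTerminates p K :=
  permissiblyTerminates_antitone (fun A E hAE => Regime.mohWindowSurfaceFormalInsep_le_formalGeom A E hAE) h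

/-- **The typed rungs from the résumé-free rung**: for EVERY notion instance `N` and reading `Rd`, `Terminates ∧ TerminatesNabla` on the
regime. [folklore] -/
theorem terminates_and_terminatesNabla_of_mohWindowSurfaceFormalGeomPermissiblyTerminates
    (h : MohWindowSurfaceFormalGeomPermissiblyTerminates p K) (n : ℕ) (N : Notions.{0} n) (Rd : Reading p K N) :
    Terminates N Rd (Regime.mohWindowSurfaceFormalGeom (p := p) (K := K)) ∧
      TerminatesNabla N Rd (Regime.mohWindowSurfaceFormalGeom (p := p) (K := K)) :=
  ⟨terminates_of_permissiblyTerminates N Rd h, terminatesNabla_of_terminates (terminates_of_permissiblyTerminates N Rd h)⟩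

end CampaignW46

end Summit.ResolutionOfSingularities.ResolutionOfSingularities.Theorems

end
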